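import Literature.AlgebraicGeometry.Motives.IntegralProjectiveSpace
import Literature.AlgebraicGeometry.Motives.GenericFibre
import HarnessLib

/-!
# The projective model of a projective `K`-scheme over a subring `R` with `Frac R = K`

Topic: `Literature/AlgebraicGeometry/Smoothening` (Bosch–Lütkebohmert–Raynaud, *Néron Models*,
§1.1 and §3.5: a proper — here projective — `K`-scheme `X_K` has a proper `R`-model, whose
`R'`-valued points recover all `K'`-valued points of `X_K` by the valuative criterion; this is the
starting point of the smoothening process for abelian varieties, which are projective,
`Motives.AbelianVariety.isProjectiveOver_holds`). For a commutative ring `R` with fraction field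
`K` and a `K`-scheme `E` with a closed `K`-immersion into some `ℙⁿ_K` (`Motives.IsProjectiveOver`,
`K` a field), the **projective model** is the scheme-theoretic closure `P` of
`E ↪ ℙⁿ_K ↪ ℙⁿ_R`: a closed subscheme of `ℙⁿ_R` (hence proper over `R`) together with
`E → P` exhibiting `E` as the generic fibre `P ×_R Spec K` (`ProjectiveModel`,
`nonempty_projectiveModel`; the cartesian square is the tree's
`Motives.isPullback_toImage_of_flat_mono`, Stacks 081I, for the flat monomorphism
`Spec K → Spec R`, with `ℙⁿ_K = ℙⁿ_R ×_R Spec K`, `Motives.ProjBaseChangeRing.isPullback_projMap`).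
[folklore]; no named facts (D-0026).

## References

* S. Bosch, W. Lütkebohmert, M. Raynaud, *Néron Models*, Springer 1990, §1.1, §3.5.
  [BLRNeronModels1990] (Not held; numbers only.)
* The Stacks Project, Tags 081I, 01R8 (scheme-theoretic image). [StacksProject]
-/

noncomputable section

open CategoryTheory CategoryTheory.Limits AlgebraicGeometry
open Literature.AlgebraicGeometry.Motives

attribute [local instance] MvPolynomial.gradedAlgebra
  Literature.AlgebraicGeometry.Motives.ProjBaseChange.algebraBase

namespace Literature.AlgebraicGeometry.Smoothening

universe u

/-- **A projective model** of the `K`-scheme `E` over `R` (`K = Frac R`): a closed subscheme `P`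
of some `ℙⁿ_R` and a morphism `E → P` over `Spec K → Spec R` making `E` the generic fibre
`P ×_R Spec K`. [folklore] -/
structure ProjectiveModel (R K : Type u) [CommRing R] [Field K] [Algebra R K] (E : SchemeOver K) :
    Type (u + 1) where
  /-- the dimension of the ambient projective space -/
  n : ℕ
  /-- the model -/
  P : Scheme.{u}
  /-- the closed immersion into `ℙⁿ_R` -/
  emb : P ⟶ Proj (MvPolynomial.homogeneousSubmodule (Fin (n + 1)) R)
  [isClosedImmersion : IsClosedImmersion emb]
  /-- the inclusion of the generic fibre -/
  gen : E.left ⟶ P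
  /-- `E = P ×_R Spec K` -/
  isPullback : IsPullback gen E.hom (emb ≫ ProjBaseChangeRing.projToSpec (Fin (n + 1)) R)
    (Spec.map (CommRingCat.ofHom (algebraMap R K)))

attribute [instance] ProjectiveModel.isClosedImmersion

namespace ProjectiveModel

variable {R K : Type u} [CommRing R] [Field K] [Algebra R K] {E : SchemeOver K}
  (M : ProjectiveModel R K E)

/-- The structure morphism `P → ℙⁿ_R → Spec R` of a projective model. [folklore] -/
abbrev hom : M.P ⟶ Spec (.of R) := M.emb ≫ ProjBaseChangeRing.projToSpec (Fin (M.n + 1)) R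

/-- A projective model is proper over `R` (`ℙⁿ_R → Spec R` is proper,
`Motives.ProjBaseChangeRing.isProper_projToSpec`). [folklore] -/
instance isProper_hom : IsProper M.hom :=
  haveI := ProjBaseChangeRing.isProper_projToSpec (Fin (M.n + 1)) R
  inferInstance

/-- The generic fibre inclusion lies over `Spec K → Spec R`. [folklore] -/
theorem gen_hom : M.gen ≫ M.hom = E.hom ≫ Spec.map (CommRingCat.ofHom (algebraMap R K)) :=
  M.isPullback.w

end ProjectiveModel

variable (R K : Type u) [CommRing R] [Field K] [Algebra R K] [IsFractionRing R K]

/-- **Projective `K`-schemes have projective models over `R`** (`K = Frac R`): the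
scheme-theoretic closure in `ℙⁿ_R` of a closed `E ↪ ℙⁿ_K`. [cite: StacksProject, Tag 081I] -/
theorem nonempty_projectiveModel (E : SchemeOver K) (hE : IsProjectiveOver E) :
    Nonempty (ProjectiveModel R K E) := by
  obtain ⟨n, ι, hι⟩ := hE
  haveI : @IsClosedImmersion E.left (Proj (MvPolynomial.homogeneousSubmodule (Fin (n + 1)) K)) ι.left := hι
  haveI : Module.Flat R K := IsLocalization.flat K (nonZeroDivisors R)
  -- the base change `Spec K → Spec R`, a flat monomorphism
  haveI : Flat (Spec.map (CommRingCat.ofHom (algebraMap R K))) :=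
    Motives.flat_specMap_of_isLocalization R K (nonZeroDivisors R)
  haveI : Mono (Spec.map (CommRingCat.ofHom (algebraMap R K))) :=
    Motives.mono_specMap_of_isLocalization R K (nonZeroDivisors R)
  -- `ℙⁿ_K = ℙⁿ_R ×_R Spec K`
  obtain ⟨φ, hφ⟩ : ∃ φ, φ = Proj.map (ProjBaseChangeRing.mapGraded R K (Fin (n + 1)))
      (ProjBaseChangeRing.irrelevant_le_map R K (Fin (n + 1))) := ⟨_, rfl⟩
  have hP : IsPullback φ (ProjBaseChangeRing.projToSpec (Fin (n + 1)) K)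
      (ProjBaseChangeRing.projToSpec (Fin (n + 1)) R) (Spec.map (CommRingCat.ofHom (algebraMap R K))) :=
    hφ ▸ ProjBaseChangeRing.isPullback_projMap R K (Fin (n + 1))
  haveI : QuasiCompact φ := MorphismProperty.of_isPullback hP.flip inferInstance
  have hιw : ι.left ≫ ProjBaseChangeRing.projToSpec (Fin (n + 1)) K = E.hom := Over.w ι
  have Hgen := Motives.isPullback_toImage_of_flat_mono (Spec.map (CommRingCat.ofHom (algebraMap R K)))
    (ProjBaseChangeRing.projToSpec (Fin (n + 1)) R) (ProjBaseChangeRing.projToSpec (Fin (n + 1)) K)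
    φ hP ι.left E.hom hιw
  exact ⟨ProjectiveModel.mk n (ι.left ≫ φ).image (ι.left ≫ φ).imageι (ι.left ≫ φ).toImage Hgen⟩

end Literature.AlgebraicGeometry.Smoothening

end
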